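import Literature.IUT.HodgeArakelov.GaloisPairRigiditySubdag
import Literature.IUT.HodgeArakelov.AbsTopQuotientMaps

/-!
# [IUTchII] §1, Corollary 1.11 sub-DAG, row S4: the `Π`-transport input reduced to `(l·Δ_Θ)(−)`

Mochizuki, *Inter-universal Teichmüller theory II*, §1, Corollary 1.11, kurims manuscript (Dec. 2020)
p. 49 [claim: Mochizuki2012, status: disputed] (IUTchII §1 Cor 1.11, kurims p.49). Record-only typing under
the claim key `Mochizuki2012` (D-0012, disputed); abc-iut cell, layer L6, sub-DAG of `IUTchII:Cor1.11`
(holder abc-iut-w5-d089), glue of the two landed files `GaloisPairRigiditySubdag` (p413682: the functor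
`ℛ → ℱ` of Cor. 1.11 modulo the INPUT structure `GaloisPairRigidityData.PiTransport`) and
`AbsTopQuotientMaps` (p413731: the isomorphism `Π/Δ ≅ Π*/Δ*` induced by `Π ≅ Π*`, CONSTRUCTED).

Row S4 asked the producer of `GaloisPairRigidityData` for three things: the induced map of quotients
(`quotHom`), the transport of `(l·Δ_Θ)(−)` (`mapLD`) and the naturality of the [AbsTopIII] Cor. 1.10 (c)
isomorphism (`corPiX_natural`). The first is now unconditional (`AbsTopMonoids.quotMap`), so the input
SHRINKS to the last two: `PiTransport.ofMapLD` builds the full input structure from a functorial transport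
`mapLD` of `(l·Δ_Θ)(−)` along isomorphisms `Π ≅ Π*` ([EtTh] Cor. 2.18 (i): "(l·Δ_Θ)(Π)" is the output of
a functorial group-theoretic algorithm) that is compatible with `corPiX` through `quotMap` ("the natural
isomorphism `μ_Ẑ(G_k) ≅ μ_Ẑ(Π_X)` of [AbsTopIII], Corollary 1.10, (c)" is natural). Consequently the
functor of record `cor111FunctorOfMapLD` and its multiradiality need only that datum. No named fact;
nothing here bears on [IUTchIII] Cor. 3.12.
-/

namespace Literature.IUT.HodgeArakelov

open CategoryTheory

universe u

variable {S : ThetaSetting.{u}} {A : AbsTopMonoids S} (D : GaloisPairRigidityData A)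

namespace GaloisPairRigidityData

/-- **S4 (reduced input)** (IUTchII:Cor1.11 (b), kurims p. 49 ll. 32–35 + l. 43): a functorial transport of
`(l·Δ_Θ)(−)` along isomorphisms `Π ≅ Π*`, compatible with the [AbsTopIII] Cor. 1.10 (c) isomorphism
`corPiX` through the INDUCED isomorphism of quotients `AbsTopMonoids.quotMap` (p413731).
[claim: Mochizuki2012, status: disputed] (IUTchII §1 Cor 1.11, kurims p.49) -/
structure LDTransport (D : GaloisPairRigidityData A) : Type (u + 1) where
  /-- transport of `(l·Δ_Θ)(−)` along `Π ≅ Π*` -/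
  mapLD : ∀ {P Q : IsoClass S.PiX}, (P ⟶ Q) → (D.lDeltaTheta P ≃* D.lDeltaTheta Q)
  mapLD_id : ∀ P : IsoClass S.PiX, mapLD (𝟙 P) = MulEquiv.refl (D.lDeltaTheta P)
  mapLD_comp : ∀ {P Q R : IsoClass S.PiX} (f : P ⟶ Q) (g : Q ⟶ R),
    mapLD (f ≫ g) = (mapLD f).trans (mapLD g)
  /-- naturality of `corPiX` with respect to the induced map of quotients -/
  corPiX_natural : ∀ {P Q : IsoClass S.PiX} (h : P ⟶ Q) (x : D.muZhat (A.quotObj P)),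
    D.corPiX Q (D.mapMu (A.quotMap h) x) = mapLD h (D.corPiX P x)

/-- **S4 glue**: the full `Π`-transport input of the Cor. 1.11 functor from the reduced datum, taking the
induced map of quotients to be the CONSTRUCTED `AbsTopMonoids.quotMap` (its three laws are
`quotMap_id/_comp/_mk`). [claim: Mochizuki2012, status: disputed] (IUTchII §1 Cor 1.11, kurims p.49) -/
def PiTransport.ofMapLD (T : D.LDTransport) : D.PiTransport where
  quotHom h := A.quotMap h
  quotHom_id P := A.quotMap_id P
  quotHom_comp f g := A.quotMap_comp f g
  quotHom_mk h x := A.quotMap_mk h x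
  mapLD h := T.mapLD h
  mapLD_id P := T.mapLD_id P
  mapLD_comp f g := T.mapLD_comp f g
  corPiX_natural h x := T.corPiX_natural h x

/-- **IUTchII:Cor1.11** (kurims p. 49 ll. 36–44), the functor `ℛ → ℱ` of record over the REDUCED input:
`cor111Functor` with the induced quotient maps supplied by `AbsTopMonoids.quotMap`.
[claim: Mochizuki2012, status: disputed] (IUTchII §1 Cor 1.11, kurims p.49) -/
abbrev cor111FunctorOfMapLD (Γ : Subgroup ZHatUnits) (T : D.LDTransport) (Γ' : Type u) [Group Γ'] :
    IsoClass S.PiX × TwistedIsoClass S.Gk Γ' ⥤ Cor111Tuple.{u} :=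
  D.cor111Functor Γ (PiTransport.ofMapLD D T) Γ'

end GaloisPairRigidityData

/-- **IUTchII:Cor1.11** (kurims p. 49 ll. 44–46) "the resulting natural functor `Ψ_ℛ : ℛ → ℛ†` … is
multiradially defined", at the functor of record over the reduced input. [claim: Mochizuki2012, status:
disputed] (IUTchII §1 Cor 1.11, kurims p.49) -/
theorem cor111FunctorOfMapLD_multiradiallyDefined (D : GaloisPairRigidityData A) (Γ : Subgroup ZHatUnits)
    (T : D.LDTransport) (Γ' : Type u) [Group Γ'] :
    ((ex18iii S Γ').toDagger (D.cor111FunctorOfMapLD Γ T Γ')).IsMultiradiallyDefined :=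
  cor111Functor_multiradiallyDefined D Γ (GaloisPairRigidityData.PiTransport.ofMapLD D T) Γ'

end Literature.IUT.HodgeArakelov
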